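import Summits.ValiantsHypothesis.ValiantsHypothesis.Theses.CirculantFourier
import Literature.Computability.AlgebraicComplexity.ConstantFreeValiant
import Literature.Computability.AlgebraicComplexity.ValiantClassesProofs
import Literature.Computability.AlgebraicComplexity.ValiantConjectureEquivProofs
import Summits.ValiantsHypothesis.ValiantsHypothesis.Theorems.CirculantFourierTargetImpliesSensitive
import Summits.ValiantsHypothesis.ValiantsHypothesis.Theorems.CirculantFourierCircHub

/-!
# Sketch — typed candidate pieces for a BC2-redirect decomposition of
`CirculantFourier.CircPermNotPComputable` (crux-strategist census, stmt-ValiantsHypothesis-6301)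

Every `def … : Prop` below is a CANDIDATE PIECE `Xᵢ` of a decomposition `X₁ ∧ … ∧ X_k → X`
(X = `CircPermNotPComputable`), stated over existing declarations only.  The census
(`STRATEGY-CENSUS.md`) records, per candidate split, which of the BC2-redirect clauses
(a) load-bearing / (b) non-trivial proved assembly / (c) no piece ≡ X or ≡ S it violates.
Nothing here is filed as an item.
-/

noncomputable section

set_option linter.dupNamespace false

namespace Summit.ValiantsHypothesis.ValiantsHypothesis.Cruxes.CircPermNotPComputable.Census

open Literature.Computability.AlgebraicComplexity
open Summit.ValiantsHypothesis.ValiantsHypothesis.Theses.CirculantFourier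
open scoped BigOperators

/-- The circulant permanent `q_n = per(x_{i-j})` over a commutative semiring `k`. -/
def circPerm (k : Type*) [CommSemiring k] (n : ℕ) : MvPolynomial (Fin n) k :=
  (Matrix.circulant fun i : Fin n => (MvPolynomial.X i : MvPolynomial (Fin n) k)).permanent

/-- The Fourier (boson-sampling) form `QF_n(μ) = q_n(x(μ))`, verbatim as in the route file. -/
def fourierForm (n : ℕ) : MvPolynomial (Fin n) ℂ :=
  MvPolynomial.aeval (fun d : Fin n => ∑ m : Fin n,
      MvPolynomial.C (Complex.exp (2 * Real.pi * Complex.I * ((d : ℕ) : ℂ) * ((m : ℕ) : ℂ) / (n : ℂ))) *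
        MvPolynomial.X m)
    (circPerm ℂ n)

/-- Monotone easiness of `U_n + ε·QF_n` at size `s` (the inner clause of the route's
`SensitiveMonotoneHard`, factored out). -/
def SensEasy (n : ℕ) (ε : ℝ) (s : ℕ) : Prop :=
  ∃ (g : MvPolynomial (Fin n) NNReal) (P : ArithCircuit NNReal (Fin n)),
    MvPolynomial.map (Complex.ofRealHom.comp NNReal.toRealHom) g =
        (1 + ∑ i : Fin n, MvPolynomial.X i) ^ n + MvPolynomial.C (ε : ℂ) * fourierForm n ∧
      Literature.Barriers.ValiantsHypothesis.IsMonotoneComputation P g ∧ P.size ≤ s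

/-! ### D1 — the monotone normal form (route crux #2) -/

/-- D1 piece = the route's `SensitiveMonotoneHard` (≡ X: both implications landed). -/
abbrev D1_SMH : Prop := SensitiveMonotoneHard

/-! ### D2 — summit ∧ completeness -/

/-- D2 piece 1: Valiant's hypothesis in its permanent form (≡ S, landed iff
`perNotPComputableComplex_iff_holds`). -/
def D2_PerHard : Prop := ¬ IsPComputable fun n => perPoly (Fin n) ℂ

/-- D2 piece 2: the permanent IS a p-projection of the circulant permanent (negation of route
crux #5 `PerNotPProjection`; open). -/
def D2_PerLeCirc : Prop := IsPProjection (fun n => perPoly (Fin n) ℂ) (circPerm ℂ)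

/-! ### D3 — ε-regime split of the monotone normal form (a.e. forms, so that the two regimes
share the witness `n`) -/

/-- D3 piece 1 (large ε, CDGM scale): eventually, no `ε ∈ [2^{-ηn}, 1)` is easy. -/
def D3_LargeEps (η : ℝ) : Prop :=
  ∀ c : ℕ, ∃ N : ℕ, ∀ n ≥ N, ∀ ε : ℝ, (2 : ℝ) ^ (-(η * n)) ≤ ε → ε < 1 → ¬ SensEasy n ε (n ^ c + c)

/-- D3 piece 2 (small ε): eventually, no `ε ∈ (0, 2^{-ηn})` is easy. -/
def D3_SmallEps (η : ℝ) : Prop :=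
  ∀ c : ℕ, ∃ N : ℕ, ∀ n ≥ N, ∀ ε : ℝ, 0 < ε → ε < (2 : ℝ) ^ (-(η * n)) → ¬ SensEasy n ε (n ^ c + c)

/-- The a.e. form of `SensitiveMonotoneHard` that D3 assembles to (stronger than the route's
i.o. form, which in turn is ≡ X). -/
def D3_SMH_ae : Prop :=
  ∀ c : ℕ, ∃ N : ℕ, ∀ n ≥ N, ∀ ε : ℝ, 0 < ε → ε < 1 → ¬ SensEasy n ε (n ^ c + c)

/-- D3's assembly is pure quantifier bookkeeping (a trivial seam): -/
theorem D3_assembly (η : ℝ) (h₁ : D3_LargeEps η) (h₂ : D3_SmallEps η) : D3_SMH_ae := by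
  intro c
  obtain ⟨N₁, hN₁⟩ := h₁ c
  obtain ⟨N₂, hN₂⟩ := h₂ c
  refine ⟨max N₁ N₂, fun n hn ε hε0 hε1 => ?_⟩
  rcases lt_or_ge ε ((2 : ℝ) ^ (-(η * n))) with hlt | hle
  · exact hN₂ n (le_trans (le_max_right _ _) hn) ε hε0 hlt
  · exact hN₁ n (le_trans (le_max_left _ _) hn) ε hle hε1

/-! ### D4 — hardness at all POLYNOMIAL rates + constant elimination -/

/-- D4 piece 1 (`R_floor`): for all `c, d` some `n ≥ 1` has the whole window
`ε ∈ [2^{-(n^d+d)}, 1)` hard at size `n^c + c` (i.o. form; a consequence of X). -/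
def D4_PolyRateHard : Prop :=
  ∀ c d : ℕ, ∃ n : ℕ, 1 ≤ n ∧ ∀ ε : ℝ, (2 : ℝ) ^ (-((n : ℝ) ^ d + d)) ≤ ε → ε < 1 →
    ¬ SensEasy n ε (n ^ c + c)

/-- D4 piece 2a (`X_cf`): the constant-free complexity `τ(2^{p(n)} q_n)` is not p-bounded for any
p-bounded `p` (constant-free Valiant-type hardness of the circulant permanent; a consequence of X
since `L_ℂ ≤ τ`). -/
def D4_TauHard : Prop :=
  ∀ p : ℕ → ℕ, IsPBounded p →
    ¬ IsPBounded fun n => constantFreeComplexity (MvPolynomial.C ((2 : ℤ) ^ p n) * circPerm ℤ n)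

/-- D4 piece 2b (`CE_q`, constant elimination FOR q — implication-shaped, antecedent `¬X`):
if `q` is p-computable over `ℂ` then some `τ(2^{p(n)} q_n)` is p-bounded. -/
def D4_ConstElim_q : Prop :=
  IsPComputable (circPerm ℂ) →
    ∃ p : ℕ → ℕ, IsPBounded p ∧
      IsPBounded fun n => constantFreeComplexity (MvPolynomial.C ((2 : ℤ) ^ p n) * circPerm ℤ n)

/-- D4 piece 2c (`CE_gen`, constant elimination for ALL integer p-families — Bürgisser's open
"VP = VNP ⇒ VP⁰ = VNP⁰?"-type gap, not implied by X). -/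
def D4_ConstElim_gen : Prop :=
  ∀ (v : ℕ → ℕ) (f : ∀ n, MvPolynomial (Fin (v n)) ℤ), IsPFamily f →
    IsPComputable (fun n => MvPolynomial.map (Int.castRingHom ℂ) (f n)) →
      ∃ p : ℕ → ℕ, IsPBounded p ∧
        IsPBounded fun n => constantFreeComplexity (MvPolynomial.C ((2 : ℤ) ^ p n) * f n)

/-! ### D5 — monotone simulation for q (instance-wise transfer) + the calibration rung -/

/-- D5 piece 1 = the route's `MonotoneHard` (crux #3; a consequence of X). -/
abbrev D5_MonotoneHard : Prop := MonotoneHard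

/-- D5 piece 2 (`MonSim_q`): general circuits for `q_n` yield plain monotone circuits for `QF_n`
with a uniform polynomial overhead (instance-wise, so NOT vacuous under X). -/
def D5_MonSim : Prop :=
  ∃ C : ℕ, ∀ n : ℕ, 1 ≤ n → ∃ (g : MvPolynomial (Fin n) NNReal) (P : ArithCircuit NNReal (Fin n)),
    MvPolynomial.map (Complex.ofRealHom.comp NNReal.toRealHom) g = fourierForm n ∧
      Literature.Barriers.ValiantsHypothesis.IsMonotoneComputation P g ∧
        P.size ≤ (complexity (circPerm ℂ n) + n) ^ C + C

/-! ### D6 — strengthenings along the index set (each a single piece ≥ X) -/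

/-- D6a: almost-everywhere superpolynomial hardness. -/
def D6_HardAE : Prop :=
  ∀ c : ℕ, ∃ N : ℕ, ∀ n ≥ N, n ^ c + c < complexity (circPerm ℂ n)

/-- D6b: hardness along the primes. -/
def D6_HardPrimes : Prop :=
  ∀ c : ℕ, ∃ p : ℕ, p.Prime ∧ p ^ c + c < complexity (circPerm ℂ p)

/-- D6c: quasi-polynomial hardness (DetQP scale). -/
def D6_HardQP : Prop :=
  ¬ IsQPBounded fun n => complexity (circPerm ℂ n)


/-! ## Demos — the violations, proved (imports: two Literature proof files + two route Theorems) -/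

section Demos

/-- (c)-violation of D2 piece 1: it IS the summit (landed iff). -/
theorem D2_PerHard_iff_S : D2_PerHard ↔ _root_.ValiantsHypothesis :=
  perNotPComputableComplex_iff_holds

/-- (b)-violation of D2: the assembly is a one-liner through a landed closure fact. -/
theorem D2_assembly (h₁ : D2_PerHard) (h₂ : D2_PerLeCirc) : CircPermNotPComputable :=
  fun hq => h₁ (IsPComputable.of_isPProjection_holds h₂ hq)

/-- D6a is a single piece ≥ X (three lines of arithmetic). -/
theorem X_of_D6_HardAE (h : D6_HardAE) : CircPermNotPComputable := by
  rintro ⟨c, hc⟩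
  obtain ⟨N, hN⟩ := h c
  exact absurd (hc N) (not_le.mpr (hN N le_rfl))

/-- D6b is a single piece ≥ X. -/
theorem X_of_D6_HardPrimes (h : D6_HardPrimes) : CircPermNotPComputable := by
  rintro ⟨c, hc⟩
  obtain ⟨p, -, hp⟩ := h c
  exact absurd (hc p) (not_le.mpr hp)

/-- D6c is a single piece ≥ X. -/
theorem X_of_D6_HardQP (h : D6_HardQP) : CircPermNotPComputable :=
  fun hq => h (IsPBounded.isQPBounded hq)

/-- D4 (q-specific constant elimination) is vacuous under X … -/
theorem D4_ConstElim_q_of_X (hX : CircPermNotPComputable) : D4_ConstElim_q :=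
  fun hq => (hX hq).elim

/-- … and its assembly is modus tollens (trivial seam, (b)). -/
theorem D4q_assembly (h₁ : D4_TauHard) (h₂ : D4_ConstElim_q) : CircPermNotPComputable := by
  intro hq
  obtain ⟨p, hp, hτ⟩ := h₂ hq
  exact h₁ p hp hτ

/-- `R_floor` (hardness at all polynomial rates) is a CONSEQUENCE of X, via the landed
`targetImpliesSensitive_proof` (X → SensitiveMonotoneHard). -/
theorem D4_PolyRateHard_of_X (hX : CircPermNotPComputable) : D4_PolyRateHard := by
  have hS : SensitiveMonotoneHard :=
    Summit.ValiantsHypothesis.ValiantsHypothesis.Theorems.targetImpliesSensitive_proof hX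
  intro c d
  by_contra h
  push_neg at h
  apply hS
  refine ⟨c, fun n hn => ?_⟩
  obtain ⟨ε, hε1, hε2, g, P, hg, hP, hs⟩ := h n hn
  exact ⟨ε, lt_of_lt_of_le (by positivity) hε1, hε2, g, P, hg, hP, hs⟩

/-- The i.o. ε-regime split does NOT even assemble: only the a.e. forms do (`D3_assembly`), and
the a.e. small-ε piece is ≥ X through Hrubeš's bridge (route supports HrubesBridge, RealForms —
not re-proved here). The a.e. target is itself ≥ the route's i.o. `SensitiveMonotoneHard`: -/
theorem SMH_of_D3_SMH_ae (h : D3_SMH_ae) : SensitiveMonotoneHard := by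
  rintro ⟨c, hc⟩
  obtain ⟨N, hN⟩ := h c
  obtain ⟨ε, hε0, hε1, g, P, hg, hP, hs⟩ := hc (N + 1) (Nat.succ_le_succ (Nat.zero_le N))
  exact hN (N + 1) (Nat.le_succ N) ε hε0 hε1 ⟨g, P, hg, hP, hs⟩

end Demos

end Summit.ValiantsHypothesis.ValiantsHypothesis.Cruxes.CircPermNotPComputable.Census
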